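import Literature.AlgebraicGeometry.HodgeTheory.HolomorphicBundleChernCharacterTopDegree
import Literature.AlgebraicGeometry.HodgeTheory.HypersurfaceLefschetzProofs
import Literature.AlgebraicGeometry.Motives.ProjectiveSpaceComplexPointsOrientation
import Literature.Topology.FourManifolds.ComplexProjectiveSpaceCohomology
import HarnessLib

/-!
# Chern characters of holomorphic bundles: Voisin I, Thm. 11.32 ⊗ ℂ in the Lefschetz range and for projective space

Family `hodge`, layer `Literature/AlgebraicGeometry/HodgeTheory`. Proofs file of
`HolomorphicBundleChernCharacter`: the named fact
`span_holomorphicBundleChernCharacter_eq_algebraicClasses` (for `X` smooth projective,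
`span_ℂ {ch_p(E) : E holomorphic on X^an} = algebraicClasses X p = Nᵖ H²ᵖ(X(ℂ); ℂ)`) is PROVED in
every degree `2p`, `p ≤ dim X`, in which the cohomology of `X` is restricted from an ambient
projective space — and hence for `X = ℙᴺ_ℂ` itself in all degrees:

* `finrank_complexBetti_projectiveSpace_two_mul_eq_one`, `finrank_complexBetti_projectiveSpace_le_one`
  — `dim H²ᵖ(ℙᴺ_ℂ(ℂ); ℂ) = 1` for `p ≤ N` (and `≤ 1` always): Hatcher Thm. 3.19,
  `H^*(ℂℙᴺ) = ℤ[α]/(αᴺ⁺¹)` — the tree's `ComplexProjectiveSpace.finrank_singularCohomology_two_mul_eq_one`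
  transported along `ℙᴺ_ℂ(ℂ) ≃ₜ ℂℙᴺ` (`complexPointsProjectiveSpaceHomeomorph`);
* `span_holomorphicBundleChernCharacter_eq_algebraicClasses_of_surjective_map` — **the Lefschetz
  range**: if for some morphism `ι : X ⟶ ℙᴺ_ℂ` the pull-back `ι^* : H²ᵖ(ℙᴺ(ℂ); ℂ) → H²ᵖ(X(ℂ); ℂ)` is
  onto and `p ≤ dim X`, then the fact holds in degree `2p`: `H²ᵖ(X(ℂ); ℂ)` is then a line (of
  dimension `≤ 1`, and `∋ ch_p(𝒪(-1)|_{X^an}) ≠ 0`, `HodgeModel.exists_mem_holomorphicBundleChernCharacter_ne_zero`),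
  spanned by the Chern characters, and consists of algebraic classes (the tree's
  `algebraicClasses_eq_top_of_surjective_map`: restricted classes are supported on linear sections in
  general position). This is the situation of the Lefschetz theorem on hyperplane sections (Voisin II,
  Thm. 1.23 and Cor. 1.24: `H²ᵖ(Y, ℚ) = ℚ·hᵖ|_Y` off the middle degree of a hypersurface), to which the
  tree reduces `Voisin2003_smoothHypersurface_algebraicClasses_eq_top` (`HypersurfaceLefschetzReduction`);
* `algebraicClasses_projectiveSpace_eq_top`, `span_holomorphicBundleChernCharacter_eq_algebraicClasses_projectiveSpace`
  — **Thm. 11.32 ⊗ ℂ for `ℙᴺ_ℂ`, every degree** (`ι = 𝟙`; for `p > N` both sides vanish):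
  Voisin I, Thm. 7.14 / Lemma 7.29 (the powers of `h = c₁(𝒪_{ℙⁿ}(1))` generate `H^{2k}(ℙⁿ, ℤ)`).

Theorems only; no definitions, no named facts.

## References

* C. Voisin, *Hodge Theory and Complex Algebraic Geometry I* (CUP 2002), Thm. 7.14, Lemma 7.29,
  §11.1.2, Thm. 11.32. [VoisinHodgeI2002]
* C. Voisin, *Hodge Theory and Complex Algebraic Geometry II* (CUP 2003), §1.2.2 Thm. 1.23, §1.2.3
  Cor. 1.24–1.25. [VoisinHodgeII2003]
* A. Hatcher, *Algebraic Topology* (CUP 2002), Thm. 3.19. [HatcherAT2002]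
-/

noncomputable section

open CategoryTheory AlgebraicGeometry

namespace Literature.AlgebraicGeometry.HodgeTheory

section HodgeTheory

open Literature.AlgebraicTopology.SingularHomology Literature.AlgebraicGeometry.Motives
  Literature.Topology.FourManifolds

variable {n : ℕ} {X : Motives.SchemeOver ℂ}

/-! ### The cohomology of `ℙᴺ_ℂ(ℂ)` in even degrees is at most a line -/

/-- `ℙᴺ_ℂ` is smooth projective of dimension `N` (the tree's `isSmoothProjective_projectiveSpace_holds`,
unfolded). [cite: Hartshorne1977, II.4.8 and III.10.1] -/
theorem isSmoothProjective_projectiveSpace' (N : ℕ) : IsSmoothProjective N (projectiveSpace N ℂ) :=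
  isSmoothProjective_projectiveSpace_holds ℂ N

/-- **`dim_ℂ H²ᵖ(ℙᴺ_ℂ(ℂ); ℂ) = 1` for `p ≤ N`** (Hatcher Thm. 3.19 for `ℂℙᴺ`, transported along the
homeomorphism `ℙᴺ_ℂ(ℂ) ≃ₜ ℂℙᴺ` of Serre's comparison). [cite: HatcherAT2002, Thm. 3.19] -/
theorem finrank_complexBetti_projectiveSpace_two_mul_eq_one (N : ℕ) {p : ℕ} (hp : p ≤ N) :
    Module.finrank ℂ (complexBetti (projectiveSpace N ℂ) (2 * p)) = 1 := by
  rw [← ComplexProjectiveSpace.finrank_singularCohomology_two_mul_eq_one ℂ N p hp]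
  exact (singularCohomology.mapIso ℂ ℂ (complexPointsProjectiveSpaceHomeomorph N)
    (2 * p)).toLinearEquiv.finrank_eq.symm

/-- `dim_ℂ H²ᵖ(ℙᴺ_ℂ(ℂ); ℂ) ≤ 1` for every `p` (`= 1` for `p ≤ N`, `= 0` above the dimension).
[cite: HatcherAT2002, Thm. 3.19] -/
theorem finrank_complexBetti_projectiveSpace_le_one (N p : ℕ) :
    Module.finrank ℂ (complexBetti (projectiveSpace N ℂ) (2 * p)) ≤ 1 := by
  rcases Nat.lt_or_ge N p with hp | hp
  · haveI : Subsingleton (complexBetti (projectiveSpace N ℂ) (2 * p)) :=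
      ComplexPoints.subsingleton_singularCohomology_of_lt (isSmoothProjective_projectiveSpace' N) ℂ
        (k := 2 * p) (by omega)
    rw [Module.finrank_zero_of_subsingleton]
    exact Nat.zero_le _
  · rw [finrank_complexBetti_projectiveSpace_two_mul_eq_one N hp]

/-! ### The Lefschetz range: degrees restricted from projective space -/

/-- **Voisin I, Thm. 11.32 ⊗ ℂ in the Lefschetz range (proved).** Let `X` be smooth projective of
dimension `n`, `A` a Hodge model, `p ≤ n`, and `ι : X ⟶ ℙᴺ_ℂ` a morphism whose pull-back
`ι^* : H²ᵖ(ℙᴺ(ℂ); ℂ) → H²ᵖ(X(ℂ); ℂ)` is SURJECTIVE (e.g. a smooth hypersurface off its middle degree,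
by the Lefschetz theorem on hyperplane sections, Voisin II Thm. 1.23 / Cor. 1.24). Then the `ℂ`-span of
the `p`-th Chern characters of holomorphic bundles on `X^an` equals `algebraicClasses X p`: both are
ALL of `H²ᵖ(X(ℂ); ℂ)`, a line (`dim ≤ dim H²ᵖ(ℙᴺ(ℂ); ℂ) ≤ 1`, and non-zero since it contains
`ch_p(𝒪(-1)|_{X^an}) ≠ 0`, `HodgeModel.exists_mem_holomorphicBundleChernCharacter_ne_zero`) spanned by
that Chern character, while every restricted class is algebraic
(`algebraicClasses_eq_top_of_surjective_map`). [cite: VoisinHodgeI2002, Thm. 11.32]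
[cite: VoisinHodgeII2003, §1.2.2 Thm. 1.23 and §1.2.3 Cor. 1.24] -/
theorem span_holomorphicBundleChernCharacter_eq_algebraicClasses_of_surjective_map
    (hX : IsSmoothProjective n X) {N : ℕ} (ι : X ⟶ projectiveSpace N ℂ) (A : HodgeModel n X)
    {p : ℕ} (hp : p ≤ n) (hι : Function.Surjective (complexBetti.map ι (2 * p))) :
    Submodule.span ℂ (A.holomorphicBundleChernCharacter p) = algebraicClasses X p := by
  -- `H²ᵖ(X(ℂ); ℂ)` is finite-dimensional of dimension `≤ 1`
  haveI : Module.Finite ℂ (complexBetti (projectiveSpace N ℂ) (2 * p)) := by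
    rcases Nat.lt_or_ge N p with hpN | hpN
    · haveI : Subsingleton (complexBetti (projectiveSpace N ℂ) (2 * p)) :=
        ComplexPoints.subsingleton_singularCohomology_of_lt (isSmoothProjective_projectiveSpace' N) ℂ
          (k := 2 * p) (by omega)
      infer_instance
    · exact Module.finite_of_finrank_eq_succ (finrank_complexBetti_projectiveSpace_two_mul_eq_one N hpN)
  haveI : Module.Finite ℂ (complexBetti X (2 * p)) :=
    Module.Finite.of_surjective (complexBetti.map ι (2 * p)).hom fun c ↦ hι c
  have hle : Module.finrank ℂ (complexBetti X (2 * p)) ≤ 1 := by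
    have h := LinearMap.finrank_range_add_finrank_ker (complexBetti.map ι (2 * p)).hom
    rw [LinearMap.range_eq_top.2 fun c ↦ hι c, finrank_top] at h
    have := finrank_complexBetti_projectiveSpace_le_one N p
    omega
  -- and contains the non-zero class `ch_p(𝒪(-1))`, so it is a line spanned by it
  obtain ⟨c, hc, hc0⟩ := A.exists_mem_holomorphicBundleChernCharacter_ne_zero hX hp
  have hpos : 0 < Module.finrank ℂ (complexBetti X (2 * p)) :=
    Module.finrank_pos_iff_exists_ne_zero.2 ⟨c, hc0⟩
  have h1 : Module.finrank ℂ (complexBetti X (2 * p)) = 1 := by omega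
  have hline : (ℂ ∙ c) = ⊤ :=
    Submodule.eq_top_of_finrank_eq (by rw [finrank_span_singleton hc0, h1])
  rw [algebraicClasses_eq_top_of_surjective_map hX ι hι]
  exact eq_top_iff.2 (hline ▸ Submodule.span_mono (Set.singleton_subset_iff.2 hc))

/-! ### Projective space -/

/-- **Every class on `ℙᴺ_ℂ` is algebraic**: `algebraicClasses (ℙᴺ_ℂ) p = ⊤` in every degree (classes
restricted from projective space — here along the identity — are supported on linear subspaces in
general position, the tree's `algebraicClasses_eq_top_of_surjective_map`; Voisin I §11.1.2).
[cite: VoisinHodgeI2002, §11.1.2] -/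
theorem algebraicClasses_projectiveSpace_eq_top (N p : ℕ) : algebraicClasses (projectiveSpace N ℂ) p = ⊤ :=
  algebraicClasses_eq_top_of_surjective_map (isSmoothProjective_projectiveSpace' N) (𝟙 _)
    (by rw [complexBetti.map_id]; exact fun c ↦ ⟨c, rfl⟩)

/-- **Voisin I, Thm. 11.32 ⊗ ℂ for projective space (proved).** For every Hodge model `A` of `ℙᴺ_ℂ`
and every `p`, the `ℂ`-span of the `p`-th Chern characters of the holomorphic vector bundles on
`(ℙᴺ)^an` equals `algebraicClasses (ℙᴺ_ℂ) p`: for `p ≤ N` both are the line `H²ᵖ(ℙᴺ_ℂ(ℂ); ℂ)` —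
spanned by `ch_p(𝒪(-1)) ≠ 0` (`[ω_FS]ᵖ ≠ 0`) — and for `p > N` both vanish. (Voisin I, Thm. 7.14:
`H^*(ℙⁿ)` is generated by `h = c₁(𝒪(1))`; the case `ι = 𝟙` of the Lefschetz range.)
[cite: VoisinHodgeI2002, Thm. 11.32 and Thm. 7.14] -/
theorem span_holomorphicBundleChernCharacter_eq_algebraicClasses_projectiveSpace (N : ℕ)
    (A : HodgeModel N (projectiveSpace N ℂ)) (p : ℕ) :
    Submodule.span ℂ (A.holomorphicBundleChernCharacter p) = algebraicClasses (projectiveSpace N ℂ) p := by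
  rcases Nat.lt_or_ge N p with hp | hp
  · exact span_holomorphicBundleChernCharacter_eq_algebraicClasses_of_lt
      (isSmoothProjective_projectiveSpace' N) A hp
  · exact span_holomorphicBundleChernCharacter_eq_algebraicClasses_of_surjective_map
      (isSmoothProjective_projectiveSpace' N) (𝟙 _) A hp
      (by rw [complexBetti.map_id]; exact fun c ↦ ⟨c, rfl⟩)

end HodgeTheory

end Literature.AlgebraicGeometry.HodgeTheory

end
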